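import Literature.Analysis.Complex.AnalyticCover
import Literature.Geometry.Kaehler.AnalyticSetFiniteMaps
import HarnessLib

/-!
# Chow's theorem, Remmert–Stein at the vertex of a cone, I: the local analytic cover off the vertex

Family `hodge` (**hodge.S17**, Chow's theorem), layer `Literature/AlgebraicGeometry/Motives`.
First of the files proving the cone form of Chow's theorem
(`Literature.AlgebraicGeometry.Motives.exists_finset_isHomogeneous_of_isCone`, `ChowTheorem.lean`):
a closed cone `Z ⊆ ℂᴺ` which is analytic off the vertex is cut out by finitely many homogeneous
polynomials. The content beyond H. Cartan's homogeneous-expansion argument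
(`ChowTheoremProofs.lean`) is the **analyticity of `Z` at the vertex** — the Remmert–Stein theorem
across the point `0` [Chirka1989, §4.4 Cor., p. 48; §7.1 p. 74; Mumford1981, §4A (4.5)–(4.7)].
We prove it by the method of analytic covers (Chirka §§3.7, 4.1–4.3; Mumford §4A (4.7):
"representation of an analytic set locally as a branched covering by means of a projection"),
using the local theory of `Literature/Analysis/Complex/AnalyticCover.lean`.

## Setting (adapted coordinates)

`Z ⊆ ℂᵈ × ℂᵐ⁺¹` is closed, stable under all scalars, cut out by holomorphic equations near every
point `≠ 0`, and the fibre coordinate space is *isolating*: `Z ∩ ({0} × ℂᵐ⁺¹) ⊆ {0}`. Write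
`π (z', w) = z'`.

## Contents (all proved)

* `exists_norm_snd_le_mul_norm_fst` — **conic estimate**: `‖w‖ ≤ C ‖z'‖` on `Z` (compactness of
  the unit sphere; Chirka §7.1 / §3.1 "proper projection").
* `finite_fibre` — the fibres `{w | (z', w) ∈ Z}`, `z' ≠ 0`, are finite (compact analytic sets
  are finite, `Literature.Geometry.Kaehler.SCV.finite_of_isCompact_of_isZeroSetAt`).
* `exists_local_cover` — **the local analytic cover over a base point `z'₀ ≠ 0`**
  [Chirka1989, §3.7 Thm., §4.1]: a ball `V ∋ z'₀`, a holomorphic `Δ ≢ 0` on `V`, and a bound `K`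
  such that all fibres over `V` have at most `K` points and over a neighbourhood of every point
  of `V ∩ {Δ ≠ 0}` the set `Z` is the union of the graphs of finitely many holomorphic maps with
  pairwise distinct values (assembled from `Literature.Analysis.Complex.SCV.exists_coverSetup` and
  `….CoverSetup.exists_cover_structure` at the finitely many fibre points, made disjoint, plus
  properness of `π` on `Z` near `z'₀`).

The sequel (`ChowConeClosure.lean`, `ChowConeComponents.lean`, `ChowConeChow.lean`) builds from
this the canonical defining functions across the vertex, the decomposition of `Z`, and the
induction proving the cone form.

## References

* [Chirka1989] E. M. Chirka, *Complex Analytic Sets*, Kluwer (1989), §3.1, §3.7, §4.1–4.4, §7.1.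
* [Mumford1981] D. Mumford, *Algebraic Geometry I: Complex Projective Varieties*, §4A (4.5)–(4.7),
  §4B.
-/

noncomputable section

open scoped Topology
open Set Filter Metric Function
open Literature.Analysis.Complex.SCV (IsZeroSetAt CoverSetup exists_coverSetup rootBox
  exists_forall_ne_zero_of_not_eventuallyEq eqOn_zero_of_preconnected_of_eventuallyEq_zero)

namespace Literature.AlgebraicGeometry.Motives

section ConeLocal

variable {d m : ℕ}

/-! ### The conic estimate and finiteness of the fibres -/

/-- **Conic estimate.** If `Z ⊆ ℂᵈ × ℂᵐ⁺¹` is closed, stable under all scalars, and meets the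
fibre coordinate space `{0} × ℂᵐ⁺¹` only at the origin, then `‖w‖ ≤ C ‖z'‖` for all `(z', w) ∈ Z`:
otherwise normalised points `(z'_k, w_k) ∈ Z`, `‖w_k‖ = 1`, `z'_k → 0`, accumulate (compactness of
the unit sphere) at a point `(0, w) ∈ Z` with `‖w‖ = 1`. [Chirka, *Complex Analytic Sets*, §3.1
(proper projections), §7.1] [folklore] -/
theorem exists_norm_snd_le_mul_norm_fst {Z : Set ((Fin d → ℂ) × (Fin (m + 1) → ℂ))}
    (hcl : IsClosed Z) (hcone : ∀ (c : ℂ) (x : (Fin d → ℂ) × (Fin (m + 1) → ℂ)), x ∈ Z → c • x ∈ Z)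
    (hiso : ∀ w, ((0 : Fin d → ℂ), w) ∈ Z → w = 0) :
    ∃ C : ℝ, 0 < C ∧ ∀ x ∈ Z, ‖x.2‖ ≤ C * ‖x.1‖ := by
  by_contra hcon
  push Not at hcon
  have hk : ∀ k : ℕ, ∃ x ∈ Z, ((k : ℝ) + 1) * ‖x.1‖ < ‖x.2‖ := fun k =>
    hcon ((k : ℝ) + 1) (by positivity)
  choose x hxZ hxlt using hk
  have hx2 : ∀ k, 0 < ‖(x k).2‖ := fun k =>
    lt_of_le_of_lt (by positivity) (hxlt k)
  -- normalised points
  set y : ℕ → (Fin d → ℂ) × (Fin (m + 1) → ℂ) := fun k => ((‖(x k).2‖⁻¹ : ℝ) : ℂ) • x k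
    with hy
  have hyZ : ∀ k, y k ∈ Z := fun k => hcone _ _ (hxZ k)
  have hnorm : ∀ (k) (v : Fin (m + 1) → ℂ), ‖((‖(x k).2‖⁻¹ : ℝ) : ℂ) • v‖ = ‖(x k).2‖⁻¹ * ‖v‖ :=
    fun k v => by
      rw [norm_smul, Complex.norm_real, Real.norm_of_nonneg (inv_nonneg.2 (norm_nonneg _))]
  have hnorm' : ∀ (k) (v : Fin d → ℂ), ‖((‖(x k).2‖⁻¹ : ℝ) : ℂ) • v‖ = ‖(x k).2‖⁻¹ * ‖v‖ :=
    fun k v => by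
      rw [norm_smul, Complex.norm_real, Real.norm_of_nonneg (inv_nonneg.2 (norm_nonneg _))]
  have hy2 : ∀ k, ‖(y k).2‖ = 1 := fun k => by
    simp only [hy, Prod.smul_snd]
    rw [hnorm, inv_mul_cancel₀ (hx2 k).ne']
  have hy1 : ∀ k, ‖(y k).1‖ ≤ 1 / ((k : ℝ) + 1) := fun k => by
    simp only [hy, Prod.smul_fst]
    rw [hnorm', le_div_iff₀ (by positivity)]
    have h1 := hxlt k
    have h2 : ‖(x k).2‖⁻¹ * ‖(x k).1‖ * ((k : ℝ) + 1) =
        (((k : ℝ) + 1) * ‖(x k).1‖) / ‖(x k).2‖ := by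
      field_simp
    rw [h2, div_le_one (hx2 k)]
    exact h1.le
  have hyball : ∀ k, y k ∈ closedBall (0 : (Fin d → ℂ) × (Fin (m + 1) → ℂ)) 1 := fun k => by
    rw [mem_closedBall, dist_zero_right, Prod.norm_def, max_le_iff]
    refine ⟨(hy1 k).trans ?_, (hy2 k).le⟩
    rw [div_le_one (by positivity)]
    linarith [(k.cast_nonneg : (0 : ℝ) ≤ k)]
  obtain ⟨p, -, φ, hφ, hlim⟩ :=
    (isCompact_closedBall (0 : ((Fin d → ℂ) × (Fin (m + 1) → ℂ))) 1).tendsto_subseq hyball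
  -- the limit point lies in `Z`, has `‖p.2‖ = 1` and `p.1 = 0`
  have hpZ : p ∈ Z := hcl.mem_of_tendsto hlim (Eventually.of_forall fun k => hyZ (φ k))
  have hp2 : ‖p.2‖ = 1 := by
    have h1 : Tendsto (fun k => ‖(y (φ k)).2‖) atTop (𝓝 ‖p.2‖) :=
      ((continuous_snd.tendsto p).comp hlim).norm
    have h2 : Tendsto (fun k => ‖(y (φ k)).2‖) atTop (𝓝 1) := by
      simp only [hy2]; exact tendsto_const_nhds
    exact tendsto_nhds_unique h1 h2
  have hp1 : p.1 = 0 := by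
    have h1 : Tendsto (fun k => ‖(y (φ k)).1‖) atTop (𝓝 ‖p.1‖) :=
      ((continuous_fst.tendsto p).comp hlim).norm
    have h2 : Tendsto (fun k => ‖(y (φ k)).1‖) atTop (𝓝 0) := by
      refine squeeze_zero (fun k => norm_nonneg _) (fun k => (hy1 (φ k)).trans ?_)
        tendsto_one_div_add_atTop_nhds_zero_nat
      have hle : (k : ℝ) ≤ φ k := by exact_mod_cast hφ.id_le k
      exact one_div_le_one_div_of_le (by positivity) (by linarith)
    have := tendsto_nhds_unique h1 h2
    exact norm_eq_zero.1 this
  have hp0 : p.2 = 0 := hiso p.2 (by rw [← hp1]; exact hpZ)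
  rw [hp0, norm_zero] at hp2
  exact zero_ne_one hp2

/-- A point of `ℂᵈ × ℂᵐ⁺¹` with non-zero first component is non-zero. [folklore] -/
theorem prodMk_ne_zero_of_fst_ne_zero {z' : Fin d → ℂ} (hz' : z' ≠ 0) (w : Fin (m + 1) → ℂ) :
    ((z', w) : (Fin d → ℂ) × (Fin (m + 1) → ℂ)) ≠ 0 := fun h => hz' (congrArg Prod.fst h)

/-- **The fibres off the vertex are finite**: for `z' ≠ 0` the fibre `{w | (z', w) ∈ Z}` is a
compact subset of `ℂᵐ⁺¹` (closed, and bounded by the conic estimate) which is cut out by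
holomorphic equations near each of its points (slices of the equations of `Z`), hence finite.
[Chirka, *Complex Analytic Sets*, §3.3 Prop. 1, §3.1] [folklore] -/
theorem finite_fibre {Z : Set ((Fin d → ℂ) × (Fin (m + 1) → ℂ))} (hcl : IsClosed Z)
    (han : ∀ x : (Fin d → ℂ) × (Fin (m + 1) → ℂ), x ≠ 0 → IsZeroSetAt Z x)
    {C : ℝ} (hC : ∀ x ∈ Z, ‖x.2‖ ≤ C * ‖x.1‖) {z' : Fin d → ℂ} (hz' : z' ≠ 0) :
    {w : Fin (m + 1) → ℂ | (z', w) ∈ Z}.Finite := by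
  have hc : Continuous fun w : Fin (m + 1) → ℂ => ((z', w) : (Fin d → ℂ) × (Fin (m + 1) → ℂ)) := by
    fun_prop
  have hclosed : IsClosed {w : Fin (m + 1) → ℂ | (z', w) ∈ Z} := hcl.preimage hc
  have hbdd : Bornology.IsBounded {w : Fin (m + 1) → ℂ | (z', w) ∈ Z} := by
    refine (isBounded_closedBall (x := (0 : Fin (m + 1) → ℂ)) (r := C * ‖z'‖)).subset ?_
    intro w hw
    rw [mem_closedBall, dist_zero_right]
    exact hC (z', w) hw
  have hcpt : IsCompact {w : Fin (m + 1) → ℂ | (z', w) ∈ Z} :=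
    Metric.isCompact_of_isClosed_isBounded hclosed hbdd
  refine Literature.Geometry.Kaehler.SCV.finite_of_isCompact_of_isZeroSetAt hcpt fun w hw => ?_
  exact (han (z', w) (prodMk_ne_zero_of_fst_ne_zero hz' w)).slice

/-- Points of a finite fibre are isolated in it: near `w₀`, the only point `w` of the fibre is
`w₀` itself. [folklore] -/
theorem eventually_ne_notMem_fibre {Z : Set ((Fin d → ℂ) × (Fin (m + 1) → ℂ))} {z' : Fin d → ℂ}
    (hfin : {w : Fin (m + 1) → ℂ | (z', w) ∈ Z}.Finite) (w₀ : Fin (m + 1) → ℂ) :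
    ∀ᶠ w in 𝓝[≠] w₀, (z', w) ∉ Z := by
  have hfin' : ({w : Fin (m + 1) → ℂ | (z', w) ∈ Z} \ {w₀}).Finite :=
    hfin.subset Set.sdiff_subset
  have h1 : ∀ᶠ w in 𝓝 w₀, w ∉ {w : Fin (m + 1) → ℂ | (z', w) ∈ Z} \ {w₀} :=
    hfin'.isClosed.isOpen_compl.mem_nhds fun hmem => hmem.2 rfl
  rw [eventually_nhdsWithin_iff]
  filter_upwards [h1] with w hw hne hwZ
  exact hw ⟨hwZ, hne⟩

/-! ### Properness of the projection near a base point -/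

/-- **Properness of `π` on `Z` near a base point `z'₀ ≠ 0`**: given open sets `O w ∋ w` around the
finitely many fibre points `w` over `z'₀`, all points of `Z` over a small ball around `z'₀` have
fibre coordinate in `⋃_w O w` (closedness of `Z`, the conic bound, compactness).
[Chirka, *Complex Analytic Sets*, §3.1 (5)] [folklore] -/
theorem exists_ball_fibre_subset {Z : Set ((Fin d → ℂ) × (Fin (m + 1) → ℂ))} (hcl : IsClosed Z)
    {C : ℝ} (hC : ∀ x ∈ Z, ‖x.2‖ ≤ C * ‖x.1‖) {z'₀ : Fin d → ℂ}
    (O : (Fin (m + 1) → ℂ) → Set (Fin (m + 1) → ℂ)) (hO : ∀ w, (z'₀, w) ∈ Z → O w ∈ 𝓝 w) :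
    ∃ ε > 0, ∀ x ∈ Z, x.1 ∈ ball z'₀ ε → ∃ w, (z'₀, w) ∈ Z ∧ x.2 ∈ O w := by
  classical
  by_contra hcon
  push Not at hcon
  have hk : ∀ k : ℕ, ∃ x ∈ Z, x.1 ∈ ball z'₀ (1 / ((k : ℝ) + 1)) ∧
      ∀ w, (z'₀, w) ∈ Z → x.2 ∉ O w := fun k => hcon _ (by positivity)
  choose x hxZ hx1 hx2 using hk
  -- the fibre coordinates are bounded, hence have a convergent subsequence
  have hbd : ∀ k,
      x k ∈ closedBall z'₀ 1 ×ˢ closedBall (0 : Fin (m + 1) → ℂ) (|C| * (‖z'₀‖ + 1)) := by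
    intro k
    have hk1 : dist (x k).1 z'₀ ≤ 1 := by
      have := hx1 k
      rw [mem_ball] at this
      refine this.le.trans ?_
      rw [div_le_one (by positivity)]
      linarith [(k.cast_nonneg : (0 : ℝ) ≤ k)]
    refine mk_mem_prod (mem_closedBall.2 hk1) ?_
    rw [mem_closedBall, dist_zero_right]
    have hn : ‖(x k).1‖ ≤ ‖z'₀‖ + 1 := by
      have h1 : ‖(x k).1‖ ≤ ‖(x k).1 - z'₀‖ + ‖z'₀‖ := norm_le_norm_sub_add _ _
      rw [← dist_eq_norm] at h1
      linarith
    calc ‖(x k).2‖ ≤ C * ‖(x k).1‖ := hC _ (hxZ k)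
      _ ≤ |C| * ‖(x k).1‖ := mul_le_mul_of_nonneg_right (le_abs_self C) (norm_nonneg _)
      _ ≤ |C| * (‖z'₀‖ + 1) := mul_le_mul_of_nonneg_left hn (abs_nonneg C)
  obtain ⟨p, -, φ, hφ, hlim⟩ :=
    ((isCompact_closedBall z'₀ 1).prod (isCompact_closedBall _ _)).tendsto_subseq hbd
  have hpZ : p ∈ Z := hcl.mem_of_tendsto hlim (Eventually.of_forall fun k => hxZ (φ k))
  -- `p.1 = z'₀`
  have hp1 : p.1 = z'₀ := by
    have h1 : Tendsto (fun k => (x (φ k)).1) atTop (𝓝 p.1) :=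
      (continuous_fst.tendsto p).comp hlim
    have h2 : Tendsto (fun k => (x (φ k)).1) atTop (𝓝 z'₀) := by
      rw [tendsto_iff_dist_tendsto_zero]
      refine squeeze_zero (fun k => dist_nonneg) (fun k => ?_)
        tendsto_one_div_add_atTop_nhds_zero_nat
      have := hx1 (φ k)
      rw [mem_ball] at this
      refine this.le.trans ?_
      have hle : (k : ℝ) ≤ φ k := by exact_mod_cast hφ.id_le k
      exact one_div_le_one_div_of_le (by positivity) (by linarith)
    exact tendsto_nhds_unique h1 h2
  have hpw : (z'₀, p.2) ∈ Z := by rw [← hp1]; exact hpZ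
  -- but `x (φ k).2 ∉ O p.2` for all `k`, contradicting convergence
  have h3 : Tendsto (fun k => (x (φ k)).2) atTop (𝓝 p.2) := (continuous_snd.tendsto p).comp hlim
  have h4 : ∀ᶠ k in atTop, (x (φ k)).2 ∈ O p.2 := h3 (hO p.2 hpw)
  obtain ⟨k, hk⟩ := h4.exists
  exact hx2 (φ k) p.2 hpw hk

/-- A positive real number below a given positive number and finitely many positive numbers.
[folklore] -/
theorem exists_pos_le_forall {ι : Type*} [Finite ι] {g : ι → ℝ} (hg : ∀ i, 0 < g i) {e₀ : ℝ}
    (he₀ : 0 < e₀) : ∃ e > 0, e ≤ e₀ ∧ ∀ i, e ≤ g i := by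
  cases isEmpty_or_nonempty ι with
  | inl h => exact ⟨e₀, he₀, le_rfl, fun i => isEmptyElim i⟩
  | inr h =>
    obtain ⟨i₀, hi₀⟩ := Finite.exists_min g
    exact ⟨min e₀ (g i₀), lt_min he₀ (hg i₀), min_le_left _ _,
      fun i => (min_le_right _ _).trans (hi₀ i)⟩

/-- Finite products of holomorphic functions are holomorphic. [folklore] -/
theorem differentiableOn_prod_finset {ι : Type*} (s : Finset ι) {g : ι → (Fin d → ℂ) → ℂ}
    {U : Set (Fin d → ℂ)} (h : ∀ i ∈ s, DifferentiableOn ℂ (g i) U) :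
    DifferentiableOn ℂ (fun x => ∏ i ∈ s, g i x) U := by
  classical
  induction s using Finset.induction_on with
  | empty => simp only [Finset.prod_empty]; exact differentiableOn_const _
  | insert a s ha ih =>
    simp only [Finset.prod_insert ha]
    exact (h a (Finset.mem_insert_self a s)).mul (ih fun i hi => h i (Finset.mem_insert_of_mem hi))

/-! ### The local analytic cover over a base point off the vertex -/

/-- **Separating the fibre points**: radii `η > 0` such that the balls `ball w η`, `w` in a finite
set, are pairwise disjoint. [folklore] -/
theorem exists_pairwiseDisjoint_ball {X : Type*} [MetricSpace X] {F : Set X} (hF : F.Finite) :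
    ∃ η > 0, ∀ w ∈ F, ∀ w' ∈ F, w ≠ w' → Disjoint (ball w η) (ball w' η) := by
  classical
  rcases F.eq_empty_or_nonempty with rfl | hne
  · exact ⟨1, one_pos, fun w hw => absurd hw (notMem_empty w)⟩
  by_cases hsub : F.Subsingleton
  · refine ⟨1, one_pos, fun w hw w' hw' hne' => absurd (hsub hw hw') hne'⟩
  -- the minimal distance between distinct points
  set D : Finset ℝ := (hF.toFinset ×ˢ hF.toFinset).filter (fun q => q.1 ≠ q.2) |>.image
    fun q => dist q.1 q.2 with hD
  have hDne : D.Nonempty := by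
    rw [Set.not_subsingleton_iff] at hsub
    obtain ⟨a, ha, b, hb, hab⟩ := hsub
    refine ⟨dist a b, Finset.mem_image.2 ⟨(a, b), ?_, rfl⟩⟩
    simp [ha, hb, hab]
  have hDpos : ∀ t ∈ D, 0 < t := by
    intro t ht
    obtain ⟨q, hq, rfl⟩ := Finset.mem_image.1 ht
    simp only [Finset.mem_filter] at hq
    exact dist_pos.2 hq.2
  set δ := D.min' hDne with hδ
  have hδpos : 0 < δ := hDpos _ (Finset.min'_mem D hDne)
  refine ⟨δ / 2, by positivity, fun w hw w' hw' hne' => ?_⟩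
  have hle : δ ≤ dist w w' := by
    refine Finset.min'_le D _ (Finset.mem_image.2 ⟨(w, w'), ?_, rfl⟩)
    simp [hw, hw', hne']
  rw [disjoint_left]
  intro u hu hu'
  rw [mem_ball] at hu hu'
  have := dist_triangle_left w w' u
  linarith

/-- **The local analytic cover over a base point off the vertex** (Chirka §3.7 Thm., §4.1; the
set-up of Mumford §4A (4.7)). Let `Z ⊆ ℂᵈ × ℂᵐ⁺¹` be closed, cut out by holomorphic equations near
every point `≠ 0`, with `‖w‖ ≤ C‖z'‖` on `Z`. Then every `z'₀ ≠ 0` has a ball `V = ball z'₀ ε`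
carrying a holomorphic function `Δ`, nowhere locally identically zero on `V`, and a bound `K`,
such that: (i) every fibre `{w | (z', w) ∈ Z}`, `z' ∈ V`, has at most `K` points; (ii) around every
`y ∈ V` with `Δ y ≠ 0` there is a ball over which `Z` is the union of the graphs of finitely many
holomorphic maps with pairwise distinct values. Construction: local analytic covers
(`exists_coverSetup`, `CoverSetup.exists_cover_structure`) in pairwise disjoint boxes around the
finitely many fibre points over `z'₀`, properness of the projection (`exists_ball_fibre_subset`),
and `Δ` the product of the discriminants. [cite: Chirka1989, §3.7 Thm. and §4.1, pp. 39–43] -/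
theorem exists_local_cover {Z : Set ((Fin d → ℂ) × (Fin (m + 1) → ℂ))} (hcl : IsClosed Z)
    (han : ∀ x : (Fin d → ℂ) × (Fin (m + 1) → ℂ), x ≠ 0 → IsZeroSetAt Z x)
    {C : ℝ} (hC : ∀ x ∈ Z, ‖x.2‖ ≤ C * ‖x.1‖) {z'₀ : Fin d → ℂ} (hz'₀ : z'₀ ≠ 0) :
    ∃ ε > 0, ∃ (Δ : (Fin d → ℂ) → ℂ) (K : ℕ), DifferentiableOn ℂ Δ (ball z'₀ ε) ∧
      (∀ y ∈ ball z'₀ ε, ¬ Δ =ᶠ[𝓝 y] 0) ∧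
      (∀ y ∈ ball z'₀ ε, ∃ T : Finset (Fin (m + 1) → ℂ), T.card ≤ K ∧
        {w : Fin (m + 1) → ℂ | (y, w) ∈ Z} ⊆ ↑T) ∧
      ∀ y ∈ ball z'₀ ε, Δ y ≠ 0 →
        ∃ δ > 0, ∃ (k : ℕ) (τ : Fin k → (Fin d → ℂ) → (Fin (m + 1) → ℂ)),
        (∀ j, DifferentiableOn ℂ (τ j) (ball y δ)) ∧
        (∀ y' ∈ ball y δ, ∀ j j', j ≠ j' → τ j y' ≠ τ j' y') ∧
        ∀ y' ∈ ball y δ, ∀ w, (y', w) ∈ Z ↔ ∃ j, w = τ j y' := by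
  classical
  -- the finite fibre over `z'₀`
  have hfin : {w : Fin (m + 1) → ℂ | (z'₀, w) ∈ Z}.Finite := finite_fibre hcl han hC hz'₀
  set F₀ : Finset (Fin (m + 1) → ℂ) := hfin.toFinset with hF₀
  have hmemF₀ : ∀ w, w ∈ F₀ ↔ (z'₀, w) ∈ Z := fun w => by simp [hF₀]
  -- separation radius
  obtain ⟨η, hη, hdisj⟩ := exists_pairwiseDisjoint_ball hfin
  -- local equations at the fibre points, inside the separating balls
  have hloc : ∀ a : F₀, ∃ (W : Set ((Fin d → ℂ) × (Fin (m + 1) → ℂ))) (N : ℕ)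
      (f : (Fin d → ℂ) × (Fin (m + 1) → ℂ) → (Fin N → ℂ)), IsOpen W ∧
      ((z'₀, (a : Fin (m + 1) → ℂ)) : (Fin d → ℂ) × (Fin (m + 1) → ℂ)) ∈ W ∧
      W ⊆ univ ×ˢ ball (a : Fin (m + 1) → ℂ) η ∧
      DifferentiableOn ℂ f W ∧ Z ∩ W = W ∩ f ⁻¹' {0} := by
    intro a
    have haZ : (z'₀, (a : Fin (m + 1) → ℂ)) ∈ Z := (hmemF₀ a).1 a.2
    obtain ⟨W, hW, hxW, N, f, hf, hZW⟩ := han _ (prodMk_ne_zero_of_fst_ne_zero hz'₀ a)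
    refine ⟨W ∩ univ ×ˢ ball (a : Fin (m + 1) → ℂ) η, N, f,
      hW.inter (isOpen_univ.prod isOpen_ball), ⟨hxW, mem_univ _, mem_ball_self hη⟩,
      inter_subset_right, hf.mono inter_subset_left, ?_⟩
    rw [← inter_assoc, hZW]
    ext x
    simp only [mem_inter_iff, mem_preimage]
    tauto
  choose W N f hWo hxW hWsub hf hZW using hloc
  -- isolation of the fibre points
  have hiso : ∀ a : F₀, ∀ᶠ w in 𝓝[≠] (a : Fin (m + 1) → ℂ), f a (z'₀, w) ≠ 0 := by
    intro a
    have h1 := eventually_ne_notMem_fibre hfin (a : Fin (m + 1) → ℂ)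
    have h2 : ∀ᶠ w in 𝓝 (a : Fin (m + 1) → ℂ),
        ((z'₀, w) : (Fin d → ℂ) × (Fin (m + 1) → ℂ)) ∈ W a := by
      have hc : Continuous fun w : Fin (m + 1) → ℂ =>
        ((z'₀, w) : (Fin d → ℂ) × (Fin (m + 1) → ℂ)) := by fun_prop
      exact hc.continuousAt.eventually ((hWo a).mem_nhds (hxW a))
    filter_upwards [h1, mem_nhdsWithin_of_mem_nhds h2] with w hw1 hw2 hf0
    exact hw1 (((hZW a).symm.subset ⟨hw2, hf0⟩).1)
  -- the local analytic covers
  have hcov : ∀ a : F₀, ∃ (ε r C' : ℝ) (Fs : Fin (m + 1) → (Fin d → ℂ) × ℂ → ℂ)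
      (rr RR : Fin (m + 1) → ℝ), CoverSetup (f a) z'₀ (a : Fin (m + 1) → ℂ) ε r C' Fs rr RR ∧
        ball z'₀ ε ×ˢ closedBall (a : Fin (m + 1) → ℂ) r ⊆ W a := fun a =>
    exists_coverSetup (hWo a) (hf a) (a := (z'₀, (a : Fin (m + 1) → ℂ))) (hxW a) (hiso a)
  choose ε r C' Fs rr RR hS hboxW using hcov
  have hrη : ∀ a : F₀, closedBall (a : Fin (m + 1) → ℂ) (r a) ⊆ ball (a : Fin (m + 1) → ℂ) η := by
    intro a w hw
    have : ((z'₀, w) : (Fin d → ℂ) × (Fin (m + 1) → ℂ)) ∈ W a :=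
      hboxW a (mk_mem_prod (mem_ball_self (hS a).ε_pos) hw)
    exact (hWsub a this).2
  -- discriminants
  choose Δ hΔd hΔne hΔcov using fun a : F₀ => (hS a).exists_cover_structure
  -- properness: a base ball over which all of `Z` lies in the open boxes
  obtain ⟨ε₁, hε₁, hprop⟩ := exists_ball_fibre_subset hcl hC
    (fun w => if hw : (z'₀, w) ∈ Z then ball w (r ⟨w, (hmemF₀ w).2 hw⟩) else univ) (by
      intro w hw
      rw [dif_pos hw]
      exact ball_mem_nhds _ (hS ⟨w, (hmemF₀ w).2 hw⟩).r_pos)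
  -- the base ball
  obtain ⟨ε₀, hε₀, hε₀₁, hε₀a⟩ :=
    exists_pos_le_forall (ι := F₀) (g := fun a => ε a) (fun a => (hS a).ε_pos) hε₁
  have hballa : ∀ a : F₀, ball z'₀ ε₀ ⊆ ball z'₀ (ε a) := fun a => ball_subset_ball (hε₀a a)
  -- over the base ball, `Z` lies in the open boxes
  have hZbox : ∀ x ∈ Z, x.1 ∈ ball z'₀ ε₀ →
      ∃ a : F₀, x.2 ∈ ball (a : Fin (m + 1) → ℂ) (r a) := by
    intro x hx hx1
    obtain ⟨w, hw, hxw⟩ := hprop x hx (ball_subset_ball hε₀₁ hx1)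
    rw [dif_pos hw] at hxw
    exact ⟨⟨w, (hmemF₀ w).2 hw⟩, hxw⟩
  -- in the boxes, `Z` is the zero set of the local equations
  have hZiff : ∀ (a : F₀) (x : (Fin d → ℂ) × (Fin (m + 1) → ℂ)), x.1 ∈ ball z'₀ (ε a) →
      x.2 ∈ closedBall (a : Fin (m + 1) → ℂ) (r a) → (x ∈ Z ↔ f a x = 0) := by
    intro a x hx1 hx2
    have hxW : x ∈ W a := hboxW a (mk_mem_prod hx1 hx2)
    constructor
    · intro hx
      have := (hZW a).subset ⟨hx, hxW⟩
      simpa using this.2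
    · intro hfx
      exact ((hZW a).symm.subset ⟨hxW, by simpa using hfx⟩).1
  have hΔd' : ∀ a : F₀, DifferentiableOn ℂ (Δ a) (ball z'₀ ε₀) := fun a =>
    (hΔd a).mono (hballa a)
  have hPd : DifferentiableOn ℂ (fun y => ∏ a ∈ F₀.attach, Δ a y) (ball z'₀ ε₀) :=
    differentiableOn_prod_finset _ fun a _ => hΔd' a
  refine ⟨ε₀, hε₀, fun y => ∏ a ∈ F₀.attach, Δ a y, ∑ a ∈ F₀.attach, (hS a).boxBound, hPd,
    ?_, ?_, ?_⟩
  · -- `Δ` is nowhere locally identically zero on the base ball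
    intro y hy hzero
    obtain ⟨z₁, hz₁, hz₁ne⟩ := exists_forall_ne_zero_of_not_eventuallyEq F₀.attach isOpen_ball
      ⟨z'₀, mem_ball_self hε₀⟩ (fun a _ => (hΔd' a).continuousOn)
      (fun a _ z hz => hΔne a z (hballa a hz))
    have hprod : (fun y => ∏ a ∈ F₀.attach, Δ a y) z₁ ≠ 0 :=
      Finset.prod_ne_zero_iff.2 fun a ha => hz₁ne a ha
    exact hprod (eqOn_zero_of_preconnected_of_eventuallyEq_zero hPd isOpen_ball
      (convex_ball _ _).isPreconnected hy hzero hz₁)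
  · -- the fibres over the base ball have at most `K` points
    intro y hy
    refine ⟨F₀.attach.biUnion fun a => rootBox (Fs a) (a : Fin (m + 1) → ℂ) (rr a) y, ?_, ?_⟩
    · exact Finset.card_biUnion_le.trans
        (Finset.sum_le_sum fun a _ => (hS a).card_rootBox_le (hballa a hy))
    · intro w hw
      obtain ⟨a, ha⟩ := hZbox (y, w) hw hy
      refine Finset.mem_coe.2 (Finset.mem_biUnion.2 ⟨a, Finset.mem_attach _ a, ?_⟩)
      have hx : ((y, w) : (Fin d → ℂ) × (Fin (m + 1) → ℂ)) ∈
          ball z'₀ (ε a) ×ˢ closedBall (a : Fin (m + 1) → ℂ) (r a) :=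
        mk_mem_prod (hballa a hy) (ball_subset_closedBall ha)
      exact (hS a).mem_rootBox_of_zero (x := (y, w)) hx
        ((hZiff a (y, w) (hballa a hy) (ball_subset_closedBall ha)).1 hw)
  · -- sheets near a good point
    intro y hy hΔy
    have hΔy' : ∀ a : F₀, Δ a y ≠ 0 := fun a =>
      (Finset.prod_ne_zero_iff.1 hΔy) a (Finset.mem_attach _ a)
    choose δ hδ hδball n σ hσd hσne hσbox hσiff using
      fun a : F₀ => hΔcov a y (hballa a hy) (hΔy' a)
    have hyε : 0 < ε₀ - dist y z'₀ := by rw [mem_ball] at hy; linarith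
    obtain ⟨δ₀, hδ₀, hδ₀y, hδ₀a⟩ :=
      exists_pos_le_forall (ι := F₀) (g := fun a => δ a) (fun a => hδ a) hyε
    have hball0 : ball y δ₀ ⊆ ball z'₀ ε₀ := ball_subset_ball' (by linarith)
    have hballδ : ∀ a : F₀, ball y δ₀ ⊆ ball y (δ a) := fun a => ball_subset_ball (hδ₀a a)
    -- values of the sheets of box `a` lie in the separating ball of `a`
    have hσball : ∀ (a : F₀) (y' : Fin d → ℂ), y' ∈ ball y δ₀ → ∀ i,
        σ a i y' ∈ ball (a : Fin (m + 1) → ℂ) (r a) := fun a y' hy' i =>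
      (hS a).mem_ball_of_mem_box (hσbox a y' (hballδ a hy') i)
    -- index the sheets by a `Fin` type
    set ι := Σ a : F₀, Fin (n a) with hι
    set e : ι ≃ Fin (Fintype.card ι) := Fintype.equivFin ι with he
    have key : ∀ y' ∈ ball y δ₀, ∀ p q : ι, p ≠ q → σ p.1 p.2 y' ≠ σ q.1 q.2 y' := by
      rintro y' hy' ⟨a, i⟩ ⟨a', i'⟩ hpq heq
      by_cases h1 : a = a'
      · subst h1
        exact hσne a y' (hballδ a hy') i i' (fun hii' => hpq (by rw [hii'])) heq
      · have hne' : ((a : F₀) : Fin (m + 1) → ℂ) ≠ (a' : Fin (m + 1) → ℂ) :=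
          fun h => h1 (Subtype.ext h)
        have hma : σ a i y' ∈ ball ((a : F₀) : Fin (m + 1) → ℂ) η :=
          hrη a (ball_subset_closedBall (hσball a y' hy' i))
        have hma' : σ a' i' y' ∈ ball ((a' : F₀) : Fin (m + 1) → ℂ) η :=
          hrη a' (ball_subset_closedBall (hσball a' y' hy' i'))
        rw [heq] at hma
        exact Set.disjoint_left.1 (hdisj _ ((hmemF₀ _).1 a.2) _ ((hmemF₀ _).1 a'.2) hne')
          hma hma'
    refine ⟨δ₀, hδ₀, Fintype.card ι, fun j y' => σ (e.symm j).1 (e.symm j).2 y', ?_, ?_, ?_⟩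
    · intro j
      exact (hσd _ _).mono (hballδ _)
    · intro y' hy' j j' hjj'
      exact key y' hy' _ _ fun h => hjj' (e.symm.injective h)
    · intro y' hy' w
      have hy'0 : y' ∈ ball z'₀ ε₀ := hball0 hy'
      constructor
      · intro hw
        obtain ⟨a, ha⟩ := hZbox (y', w) hw hy'0
        have hf0 : f a (y', w) = 0 :=
          (hZiff a (y', w) (hballa a hy'0) (ball_subset_closedBall ha)).1 hw
        obtain ⟨i, hi⟩ := (hσiff a y' (hballδ a hy') w (ball_subset_closedBall ha)).1 hf0
        have hgen : ∀ p : ι, p = ⟨a, i⟩ → w = σ p.1 p.2 y' := by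
          rintro p rfl; exact hi
        exact ⟨e ⟨a, i⟩, hgen _ (Equiv.symm_apply_apply e _)⟩
      · rintro ⟨j, rfl⟩
        have hbox := hσball (e.symm j).1 y' hy' (e.symm j).2
        have hf0 : f (e.symm j).1 (y', σ (e.symm j).1 (e.symm j).2 y') = 0 :=
          (hσiff (e.symm j).1 y' (hballδ _ hy') _ (ball_subset_closedBall hbox)).2 ⟨_, rfl⟩
        exact (hZiff (e.symm j).1 (y', _) (hballa _ hy'0) (ball_subset_closedBall hbox)).2 hf0

end ConeLocal

end Literature.AlgebraicGeometry.Motives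

end
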